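import Mathlib.Analysis.Calculus.Deriv.Inv
import Mathlib.Analysis.Calculus.Deriv.Mul
import Mathlib.Analysis.Calculus.FDeriv.Equiv
import Literature.Analysis.FluidPDE.SelfSimilarEulerProfile
import HarnessLib

/-!
# Euler–Leray skeletons: steady self-similar Euler profiles at Leray's exponent `γ = ½` with Leray
# decay, and their dilation family

Analysis/FluidPDE definition file (request `defn-EulerLeraySkeleton` of route
`NavierStokesRegularity/MarginalReynoldsCreep`, layer-2 object of the cruxes `OneLoopCreep`,
`NoLinearCreep`; the same five clauses are inlined by route `AffineBernoulli`, items
`EulerLerayLiouville`, `AxisymEulerLerayLiouville`, `ClosedWindowSkeleton`). Definitions and proved API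
only; no named facts are introduced.

**The object.** Leray's backward self-similar ansatz `u(x,t) = (T−t)^{−1/2} U(x/√(T−t))` turns the
incompressible Euler equations into the steady system

  `½ (U + (y·∇) U) + (U·∇) U + ∇P = 0`,  `∇·U = 0`

— the **Euler–Leray equations** of Pomeau (2017/2018) and Pomeau–Le Berre–Lehner (2019), §3–§4:
"equations of the form (NS-Leray) are called NS-Leray equations if the viscosity is non-zero and
Euler-Leray equations whenever the `∇²U` is absent", with the exponents `α = β = ½` "ensuring
conservation of circulation"; it is the case `γ = ½` of the stationary self-similar Euler equation
(3.3) of Constantin–Ignatova–Vicol (2026), `(1−γ)U + γ(y·∇)U + (U·∇)U + ∇P = 0`, already in the tree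
as `IsSelfSimilarEulerProfile γ c U P` (`SelfSimilarEulerProfile.lean`). At `γ = ½` the leading
far-field behaviour dictated by the equation is `|U| ∼ |y|^{(γ−1)/γ} = |y|⁻¹`,
`|∇U| ∼ ⟨y⟩^{−1/γ} = ⟨y⟩⁻²` (CIV §3.1.3, (3.8); PLBL §5: "the velocity field `U_EL` decays like
`1/R` at large `R`"). An **Euler–Leray skeleton** is a `C²` divergence-free solution `W` of the
steady Euler–Leray system (some `C¹` pressure `P`) in exactly this decay class,
`|W(y)| ≤ C⟨y⟩⁻¹`, `|∇W(y)| ≤ C⟨y⟩⁻²` — the class `𝓔_{1/2}` over which route `MarginalReynoldsCreep`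
takes its one-loop coefficient `κ(W)` and which route `AffineBernoulli` conjectures to be `{0}`.

**The dilation family.** The Euler–Leray system has one continuous symmetry beyond rotations:
if `(U, P)` solves it then so does `(μ⁻¹ U(μ ·), μ⁻² P(μ ·))`, `μ > 0` (PLBL §5: "The Euler-Leray
equations have an interesting structure, pointed out in [YP], they are invariant under dilation";
CIV §3.1.2: "if `U` and `Ω` are a solution of (3.4) on `ℝ³`, then `U_λ(y) = λ U(y/λ)` and
`Ω_λ(y) = Ω(y/λ)` are also a solution", `λ = μ⁻¹`). Its generator at `μ = 1` is the **dilation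
mode** `∂_μ|_{μ=1} μ⁻¹W(μy) = (y·∇)W − W`, the zero mode of the linearised operator in PLBL's
solvability condition (§5, eq. (self2.6)) and in the requested `oneLoopKappa`.

## Contents

* `eulerLerayDilate μ W y = μ⁻¹ • W (μ • y)`, `eulerLerayDilatePressure μ P y = (μ²)⁻¹ P (μ • y)`:
  the dilation family; `_apply`, `_one`, the group law `eulerLerayDilate_eulerLerayDilate`, the
  chain rules `fderiv_eulerLerayDilate` (`D(W_μ)(y) = DW(μy)` for `μ ≠ 0`),
  `gradient_eulerLerayDilatePressure`, `divergence_eulerLerayDilate`, smoothness, and the dilation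
  mode `hasDerivAt_eulerLerayDilate_one` (`d/dμ|_{μ=1} W_μ(y) = DW(y)[y] − W(y)`).
* `IsSelfSimilarEulerProfile.eulerLerayDilate`: **CIV §3.1.2** — for every exponent `γ`, dilation
  maps profiles with centre `c` to profiles with centre `μ⁻¹c` (proved).
* `IsEulerLeraySkeleton W P` — **the structure requested**: `W ∈ C²`, `P ∈ C¹`, `div W = 0`,
  `½W(y) + DW(y)[½y + W(y)] + ∇P(y) = 0` for all `y`, and
  `∃ C, ∀ y, |W(y)| ≤ C(1+|y|)⁻¹ ∧ ‖DW(y)‖ ≤ C((1+|y|)²)⁻¹` — literally the clauses inlined (with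
  centre `0`) by route `AffineBernoulli` (`isEulerLeraySkeleton_iff` is by definition); API:
  `isSelfSimilarEulerProfile` / `of_isSelfSimilarEulerProfile` (it IS `IsSelfSimilarEulerProfile ½ 0`
  plus decay), Pomeau's printed form `profile_eq_convect` (`½(W + (y·∇)W) + (W·∇)W + ∇P = 0`) and the
  constructor `of_convect`, the trivial skeleton `.zero`, nonnegativity of admissible constants, and
  **`IsEulerLeraySkeleton.eulerLerayDilate`: the dilation family preserves the class** (`μ > 0`;
  constant `C ↦ C(1 + μ⁻¹)²`).
* Bridges: `IsSelfSimilarEulerProfile.isEulerLeraySkeleton_comp_add_right` (a centre-`c` profile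
  with Leray decay about `0`, as in `AffineBernoulli.EulerLerayLiouville`, translates to a skeleton,
  constant `C(1 + |c|)²`), and on `ℝ³`
  `IsSelfSimilarEulerProfile.isEulerLeraySkeleton_of_hasSelfSimilarFarFieldWith` (CIV's far-field
  class (3.8) at `γ = ½` consists of skeletons, constant `2C♭`).

## Mathlib / tree search

Mathlib has no self-similar Euler notions. Tree (`lean search 'SelfSimilarEuler|EulerLeray|Dilate|
nsRescaleData|smul_comp_smul'`): `IsSelfSimilarEulerProfile`, `selfSimilarTransport`,
`HasSelfSimilarFarFieldWith`, `convect`, `VectorCalculus.IsDivFree` (reused — the skeleton class is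
NOT a new PDE but `IsSelfSimilarEulerProfile (1/2) 0` plus decay); `IsRescaledEulerLeraySolutionOn`
(`RescaledEulerLeray.lean`: the TIME-DEPENDENT Leray system with viscosity parameter `ε`, an
abbreviation of classical Navier–Stokes — a different object, whose `ε = 0` steady solutions with
Leray decay are the skeletons; not needed here); `nsRescaleData c u₀ = c • u₀ (c • ·)`
(`SelfSimilar.lean`, the Navier–Stokes scaling — NOT the Euler–Leray dilation `μ⁻¹ • W (μ • ·)`);
the dilation chain rules `fderiv_const_smul_comp_smul'`, `divergence_smul_comp_smul` of
`LeraySelfSimilarCalculus.lean` cover `k • U(c ·)` behind the heavy `SelfSimilar`/`MildSolution`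
imports and are re-derived here in three lines from Mathlib's `fderiv_comp_smul`,
`fderiv_const_smul_field`.

## Design notes

* Stated on a finite-dimensional real inner product space `E` (free generality, as for
  `IsSelfSimilarEulerProfile`; the sources and the routes have `E = ℝ³`); the decay exponents `1`,
  `2` are Leray's (`γ = ½`) in any dimension.
* Japanese brackets are spelled `(1 + ‖y‖)⁻¹`, `((1 + ‖y‖)²)⁻¹` — the form the requesting routes
  inline — rather than `(1 + ‖y‖²)^{−1/2}` etc.; the two are comparable with absolute constants
  (`isEulerLeraySkeleton_of_hasSelfSimilarFarFieldWith` does the conversion from CIV's (3.8)).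
  Unlike CIV's (3.8) the decay clause does not contain the factor `|y|` pinning `W(0) = 0`
  (the routes do not impose it; `ClosedWindowSkeleton` even normalises `‖W 0‖ ≥ ½`).
* The pressure is an argument (`IsEulerLeraySkeleton W P`), as requested and as in
  `IsSelfSimilarEulerProfile`; "for some `C¹` pressure" is `∃ P, IsEulerLeraySkeleton W P`.
* PLBL §5 print the invariant family as "`μU(μR)`"; the computation (each term of the steady
  system must scale by the same power of `μ`: `U + R·∇U` is degree-`0` homogeneous under
  `R ↦ μR` while `U·∇U` is quadratic) fixes it to `μ⁻¹U(μR)`, which is CIV's `λU(y/λ)`,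
  `λ = μ⁻¹`, and the request's `W_μ`; this is what `eulerLerayDilate` is and what is PROVED
  invariant below.
* NOT here: the `s`-periodic (log-periodic / DSS) skeletons `∂ₛW + ½(W + y·∇W) + W·∇W + ∇Π = 0`,
  `W(s + S) = W(s)` (a possible sequel `IsEulerLerayPeriodicSkeleton`); the linearised operator
  `L_W`, its adjoint zero modes and `κ(W)` (request `defn-oneLoopKappa`); rotation invariance.

## References

* Y. Pomeau, M. Le Berre, T. Lehner, *A case of strong non linearity: intermittency in highly
  turbulent flows*, C. R. Mécanique 347 (2019) = arXiv:1806.04893, §3 (NS-Leray / Euler-Leray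
  equations, eq. (NS-Leray)), §4 (eq. (Euler-Leray1)), §5 (dilation invariance, the drift of the
  dilation parameter, eq. (self2.6)) [PomeauBerreLehner2018].
* Y. Pomeau, *On the self-similar solution to the Euler equations for an incompressible fluid in
  three dimensions*, C. R. Mécanique 346 (2018) 184–197, doi:10.1016/j.crme.2017.12.004 (the
  reference [YP] of the above for the Euler–Leray equations and their dilation invariance; cite-only,
  acq-01396) [Pomeau2017].
* P. Constantin, M. Ignatova, V. Vicol, *On putative self-similarity for incompressible 3D Euler*,
  arXiv:2602.17570 (2026), §3.1.1 eq. (3.3), §3.1.2 (space rescaling `U_λ = λU(·/λ)`), §3.1.3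
  eq. (3.8) [ConstantinIgnatovaVicol2026Putative].
-/

noncomputable section

open Set InnerProductSpace
open scoped RealInnerProductSpace

namespace Literature.Analysis.FluidPDE

/-! ### The dilation family `W_μ = μ⁻¹ W(μ ·)`, `P_μ = μ⁻² P(μ ·)` -/

section Dilation

variable {E : Type*} [NormedAddCommGroup E] [NormedSpace ℝ E]
variable {F : Type*} [NormedAddCommGroup F] [NormedSpace ℝ F]

/-- The **Euler–Leray dilation** of a profile `W` by `μ`: `W_μ(y) = μ⁻¹ W(μ y)` — the one-parameter
family of space dilations leaving the (steady or time-dependent) Euler–Leray system invariant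
(Pomeau–Le Berre–Lehner, §5: "invariant under dilation"; Constantin–Ignatova–Vicol, §3.1.2:
`U_λ(y) = λ U(y/λ)`, i.e. `λ = μ⁻¹`). Total in `μ` (for `μ = 0` it is the junk field
`0⁻¹ • W 0 = 0`); only `μ > 0` is used. [cite: ConstantinIgnatovaVicol2026Putative, §3.1.2] -/
def eulerLerayDilate (μ : ℝ) (W : E → F) : E → F :=
  fun y => μ⁻¹ • W (μ • y)

/-- The pressure accompanying the Euler–Leray dilation: `P_μ(y) = μ⁻² P(μ y)` (each term of
`½(W + y·∇W) + W·∇W + ∇P` then scales by `μ⁻¹`). [cite: ConstantinIgnatovaVicol2026Putative, §3.1.2] -/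
def eulerLerayDilatePressure (μ : ℝ) (P : E → ℝ) : E → ℝ :=
  fun y => (μ ^ 2)⁻¹ * P (μ • y)

/-- Unfolding `eulerLerayDilate` (definitional). [cite: ConstantinIgnatovaVicol2026Putative, §3.1.2] -/
@[simp]
theorem eulerLerayDilate_apply (μ : ℝ) (W : E → F) (y : E) :
    eulerLerayDilate μ W y = μ⁻¹ • W (μ • y) := rfl

/-- Unfolding `eulerLerayDilatePressure` (definitional). [cite: ConstantinIgnatovaVicol2026Putative, §3.1.2] -/
@[simp]
theorem eulerLerayDilatePressure_apply (μ : ℝ) (P : E → ℝ) (y : E) :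
    eulerLerayDilatePressure μ P y = (μ ^ 2)⁻¹ * P (μ • y) := rfl

/-- `μ = 1` is the identity of the family. [folklore] -/
@[simp]
theorem eulerLerayDilate_one (W : E → F) : eulerLerayDilate 1 W = W := by
  funext y; simp

/-- `μ = 1` is the identity on pressures. [folklore] -/
@[simp]
theorem eulerLerayDilatePressure_one (P : E → ℝ) : eulerLerayDilatePressure 1 P = P := by
  funext y; simp

/-- **Group law**: dilating by `μ'` and then by `μ` is dilating by `μ' μ` (a one-parameter group
for `μ > 0`). [folklore] -/
theorem eulerLerayDilate_eulerLerayDilate (μ μ' : ℝ) (W : E → F) :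
    eulerLerayDilate μ (eulerLerayDilate μ' W) = eulerLerayDilate (μ' * μ) W := by
  funext y
  simp only [eulerLerayDilate_apply, smul_smul, mul_inv_rev]

/-- Group law on pressures. [folklore] -/
theorem eulerLerayDilatePressure_eulerLerayDilatePressure (μ μ' : ℝ) (P : E → ℝ) :
    eulerLerayDilatePressure μ (eulerLerayDilatePressure μ' P) =
      eulerLerayDilatePressure (μ' * μ) P := by
  funext y
  simp only [eulerLerayDilatePressure_apply, smul_smul]
  ring

/-- **Chain rule for the dilation**: `D(W_μ)(y) = (μ⁻¹ μ) • DW(μ y)` (no differentiability needed: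
Mathlib's `fderiv_comp_smul`, `fderiv_const_smul_field`; cf. the tree's
`fderiv_const_smul_comp_smul'`). [folklore] -/
theorem fderiv_eulerLerayDilate (μ : ℝ) (W : E → F) (y : E) :
    fderiv ℝ (eulerLerayDilate μ W) y = (μ⁻¹ * μ) • fderiv ℝ W (μ • y) := by
  have h : eulerLerayDilate μ W = μ⁻¹ • fun z => W (μ • z) := rfl
  rw [h, fderiv_const_smul_field, Pi.smul_apply, _root_.fderiv_comp_smul, smul_smul]

/-- For `μ ≠ 0` the velocity gradient is dilation invariant: `D(W_μ)(y) = DW(μ y)` (so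
`‖∇W‖_∞` is preserved, CIV §3.1.2: `Ω_λ(y) = Ω(y/λ)`). [cite: ConstantinIgnatovaVicol2026Putative, §3.1.2] -/
theorem fderiv_eulerLerayDilate_of_ne_zero {μ : ℝ} (hμ : μ ≠ 0) (W : E → F) (y : E) :
    fderiv ℝ (eulerLerayDilate μ W) y = fderiv ℝ W (μ • y) := by
  rw [fderiv_eulerLerayDilate, inv_mul_cancel₀ hμ, one_smul]

/-- Dilation preserves `Cⁿ` regularity. [folklore] -/
theorem contDiff_eulerLerayDilate {n : WithTop ℕ∞} {W : E → F} (hW : ContDiff ℝ n W) (μ : ℝ) :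
    ContDiff ℝ n (eulerLerayDilate μ W) :=
  (hW.comp (contDiff_const_smul μ)).const_smul μ⁻¹

/-- Dilation preserves `Cⁿ` regularity of pressures. [folklore] -/
theorem contDiff_eulerLerayDilatePressure {n : WithTop ℕ∞} {P : E → ℝ} (hP : ContDiff ℝ n P)
    (μ : ℝ) : ContDiff ℝ n (eulerLerayDilatePressure μ P) :=
  contDiff_const.mul (hP.comp (contDiff_const_smul μ))

/-- **The dilation mode.** For `W` differentiable at `y`, the generator of the dilation family at
`μ = 1` is `d/dμ|_{μ=1} W_μ(y) = DW(y)[y] − W(y)`, i.e. `(y·∇)W − W` (PLBL §5: `U_d = ∂U/∂μ`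
"belongs to the non-empty kernel of the linear operator `𝓛[U_EL]`" by dilation invariance).
[cite: PomeauBerreLehner2018, §5] -/
theorem hasDerivAt_eulerLerayDilate_one {W : E → F} {y : E} (hW : DifferentiableAt ℝ W y) :
    HasDerivAt (fun μ : ℝ => eulerLerayDilate μ W y) (fderiv ℝ W y y - W y) 1 := by
  have h1 : HasDerivAt (fun μ : ℝ => μ⁻¹) (-1) 1 := by
    simpa using hasDerivAt_inv (one_ne_zero : (1 : ℝ) ≠ 0)
  have h2 : HasDerivAt (fun μ : ℝ => μ • y) y 1 := by
    simpa using (hasDerivAt_id (1 : ℝ)).smul_const y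
  have hW' : HasFDerivAt W (fderiv ℝ W y) ((fun μ : ℝ => μ • y) 1) := by
    simpa using hW.hasFDerivAt
  have h3 : HasDerivAt (fun μ : ℝ => W (μ • y)) (fderiv ℝ W y y) 1 := hW'.comp_hasDerivAt 1 h2
  have h4 : HasDerivAt (fun μ : ℝ => eulerLerayDilate μ W y)
      ((1 : ℝ)⁻¹ • fderiv ℝ W y y + (-1 : ℝ) • W ((1 : ℝ) • y)) 1 :=
    (h1.smul h3).congr_of_eventuallyEq (Filter.Eventually.of_forall fun μ => rfl)
  simpa [sub_eq_add_neg] using h4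

/-- **Leray decay is dilation-stable.** If `|W(y)| ≤ C(1+|y|)⁻¹` and `‖DW(y)‖ ≤ C((1+|y|)²)⁻¹` for
all `y`, then `W_μ = μ⁻¹W(μ ·)`, `μ > 0`, obeys the same bounds with constant `C(1 + μ⁻¹)²`
(`1 + |y| ≤ (1 + μ⁻¹)(1 + μ|y|)`). [folklore] -/
theorem decay_eulerLerayDilate {W : E → F} {C μ : ℝ} (hμ : 0 < μ)
    (h : ∀ y, ‖W y‖ ≤ C * (1 + ‖y‖)⁻¹ ∧ ‖fderiv ℝ W y‖ ≤ C * ((1 + ‖y‖) ^ 2)⁻¹) (y : E) :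
    ‖eulerLerayDilate μ W y‖ ≤ C * (1 + μ⁻¹) ^ 2 * (1 + ‖y‖)⁻¹ ∧
      ‖fderiv ℝ (eulerLerayDilate μ W) y‖ ≤ C * (1 + μ⁻¹) ^ 2 * ((1 + ‖y‖) ^ 2)⁻¹ := by
  have hC : 0 ≤ C := by
    have h0 := (h 0).1
    rw [norm_zero, add_zero, inv_one, mul_one] at h0
    exact (norm_nonneg _).trans h0
  set t : ℝ := ‖y‖ with ht
  have ht0 : 0 ≤ t := norm_nonneg _
  have hnorm : ‖μ • y‖ = μ * t := by rw [norm_smul, Real.norm_of_nonneg hμ.le]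
  have ha : 0 < 1 + μ * t := by positivity
  have hb : 0 < 1 + t := by positivity
  -- the comparison `1 + t ≤ (1 + μ⁻¹)(1 + μ t)`
  have hK : 1 + t ≤ (1 + μ⁻¹) * (1 + μ * t) := by
    have e : (1 + μ⁻¹) * (1 + μ * t) = (1 + t) + (μ * t + μ⁻¹) := by
      linear_combination t * inv_mul_cancel₀ hμ.ne'
    rw [e]
    exact le_add_of_nonneg_right (by positivity)
  have hinv : (1 + μ * t)⁻¹ ≤ (1 + μ⁻¹) * (1 + t)⁻¹ := by
    rw [← div_eq_mul_inv, le_div_iff₀ hb, inv_mul_le_iff₀ ha, mul_comm]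
    exact hK
  have hinv2 : ((1 + μ * t) ^ 2)⁻¹ ≤ (1 + μ⁻¹) ^ 2 * ((1 + t) ^ 2)⁻¹ := by
    have hK2 : (1 + t) ^ 2 ≤ (1 + μ⁻¹) ^ 2 * (1 + μ * t) ^ 2 := by
      rw [← mul_pow]; exact pow_le_pow_left₀ hb.le hK 2
    rw [← div_eq_mul_inv, le_div_iff₀ (pow_pos hb 2), inv_mul_le_iff₀ (pow_pos ha 2), mul_comm]
    exact hK2
  refine ⟨?_, ?_⟩
  · have h1 := (h (μ • y)).1
    rw [hnorm] at h1
    calc ‖eulerLerayDilate μ W y‖ = μ⁻¹ * ‖W (μ • y)‖ := by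
          rw [eulerLerayDilate_apply, norm_smul, norm_inv, Real.norm_of_nonneg hμ.le]
      _ ≤ μ⁻¹ * (C * (1 + μ * t)⁻¹) := mul_le_mul_of_nonneg_left h1 (inv_pos.2 hμ).le
      _ ≤ (1 + μ⁻¹) * (C * ((1 + μ⁻¹) * (1 + t)⁻¹)) :=
          mul_le_mul (le_add_of_nonneg_left zero_le_one) (mul_le_mul_of_nonneg_left hinv hC)
            (by positivity) (by positivity)
      _ = C * (1 + μ⁻¹) ^ 2 * (1 + t)⁻¹ := by ring
  · have h2 := (h (μ • y)).2
    rw [hnorm] at h2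
    calc ‖fderiv ℝ (eulerLerayDilate μ W) y‖ = ‖fderiv ℝ W (μ • y)‖ := by
          rw [fderiv_eulerLerayDilate_of_ne_zero hμ.ne']
      _ ≤ C * ((1 + μ * t) ^ 2)⁻¹ := h2
      _ ≤ C * ((1 + μ⁻¹) ^ 2 * ((1 + t) ^ 2)⁻¹) := mul_le_mul_of_nonneg_left hinv2 hC
      _ = C * (1 + μ⁻¹) ^ 2 * ((1 + t) ^ 2)⁻¹ := by ring

end Dilation

/-! ### Gradient and divergence under dilation; dilation of self-similar Euler profiles -/

section InnerProduct

variable {E : Type*} [NormedAddCommGroup E] [InnerProductSpace ℝ E]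

/-- `∇(P_μ)(y) = (μ⁻² μ) • (∇P)(μ y)`. [folklore] -/
theorem gradient_eulerLerayDilatePressure [CompleteSpace E] (μ : ℝ) (P : E → ℝ) (y : E) :
    gradient (eulerLerayDilatePressure μ P) y = ((μ ^ 2)⁻¹ * μ) • gradient P (μ • y) := by
  have h : eulerLerayDilatePressure μ P = (μ ^ 2)⁻¹ • fun z => P (μ • z) := by
    funext z; rfl
  rw [gradient, h, fderiv_const_smul_field, Pi.smul_apply, _root_.fderiv_comp_smul, smul_smul,
    map_smul, gradient]

variable [FiniteDimensional ℝ E]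

omit [FiniteDimensional ℝ E] in
/-- `div (W_μ)(y) = (μ⁻¹ μ) div W (μ y)`. [folklore] -/
theorem divergence_eulerLerayDilate (μ : ℝ) (W : E → E) (y : E) :
    VectorCalculus.divergence (eulerLerayDilate μ W) y =
      (μ⁻¹ * μ) * VectorCalculus.divergence W (μ • y) := by
  simp only [VectorCalculus.divergence, fderiv_eulerLerayDilate μ W y,
    ContinuousLinearMap.toLinearMap_smul, map_smul, smul_eq_mul]

omit [FiniteDimensional ℝ E] in
/-- Dilation preserves incompressibility. [folklore] -/
theorem VectorCalculus.IsDivFree.eulerLerayDilate {W : E → E} (h : VectorCalculus.IsDivFree W)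
    (μ : ℝ) : VectorCalculus.IsDivFree (eulerLerayDilate μ W) := fun y => by
  rw [divergence_eulerLerayDilate, h (μ • y), mul_zero]

/-- **Space rescaling of self-similar Euler profiles (CIV §3.1.2), any exponent `γ`.** If `(U, P)`
solves `(1−γ)U + DU[γ(y − c) + U] + ∇P = 0`, `div U = 0`, then for `μ ≠ 0` the dilated pair
`(μ⁻¹U(μ ·), μ⁻²P(μ ·))` solves it with centre `μ⁻¹c`: every term at `y` is `μ⁻¹` times the
corresponding term at `μy` ("`U_λ(y) = λU(y/λ)`, `Ω_λ(y) = Ω(y/λ)` are also a solution", `λ = μ⁻¹`,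
stated there for `c = 0`). [cite: ConstantinIgnatovaVicol2026Putative, §3.1.2] -/
theorem IsSelfSimilarEulerProfile.eulerLerayDilate {γ : ℝ} {c : E} {U : E → E} {P : E → ℝ}
    (h : IsSelfSimilarEulerProfile γ c U P) {μ : ℝ} (hμ : μ ≠ 0) :
    IsSelfSimilarEulerProfile γ (μ⁻¹ • c) (eulerLerayDilate μ U) (eulerLerayDilatePressure μ P) where
  contDiff_velocity := contDiff_eulerLerayDilate h.contDiff_velocity μ
  contDiff_pressure := contDiff_eulerLerayDilatePressure h.contDiff_pressure μ
  profile_eq y := by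
    have key := h.profile_eq (μ • y)
    have e1 : μ⁻¹ • (γ • (μ • y - c)) = γ • (y - μ⁻¹ • c) := by
      rw [smul_sub, smul_sub, smul_smul, smul_smul, show μ⁻¹ * γ * μ = γ by field_simp,
        smul_comm μ⁻¹ γ c, ← smul_sub]
    have hV : γ • (y - μ⁻¹ • c) + μ⁻¹ • U (μ • y) = μ⁻¹ • (γ • (μ • y - c) + U (μ • y)) := by
      rw [smul_add, e1]
    rw [fderiv_eulerLerayDilate_of_ne_zero hμ, gradient_eulerLerayDilatePressure,
      eulerLerayDilate_apply, hV, map_smul, show (μ ^ 2)⁻¹ * μ = μ⁻¹ by field_simp,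
      smul_comm (1 - γ) μ⁻¹ (U (μ • y)), ← smul_add, ← smul_add, key, smul_zero]
  divFree := h.divFree.eulerLerayDilate μ

end InnerProduct

/-! ### Euler–Leray skeletons -/

section Skeleton

variable {E : Type*} [NormedAddCommGroup E] [InnerProductSpace ℝ E] [FiniteDimensional ℝ E]

/-- An **Euler–Leray skeleton** `(W, P)`: a steady solution of the Euler–Leray equations
`½(W + (y·∇)W) + (W·∇)W + ∇P = 0`, `∇·W = 0` (Pomeau–Le Berre–Lehner §3–§4, eq. (NS-Leray) without
the viscous term, steady case; Pomeau 2018; = Constantin–Ignatova–Vicol (3.3) with `γ = ½`, centre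
`0`) with `W ∈ C²`, `P ∈ C¹`, in Leray's decay class `|W(y)| ≤ C⟨y⟩⁻¹`, `‖DW(y)‖ ≤ C⟨y⟩⁻²` (the
`γ = ½` far field of CIV §3.1.3; PLBL §5: "`U_EL` decays like `1/R`"). The equation is written
`½W(y) + DW(y)[½y + W(y)] + ∇P(y) = 0` (`DW(y)[½y + W(y)] = ½(y·∇)W + (W·∇)W`, see
`profile_eq_convect`) and the brackets as `(1 + |y|)⁻¹`, `((1 + |y|)²)⁻¹` — literally the clauses
inlined by routes `AffineBernoulli` / `MarginalReynoldsCreep` of `NavierStokesRegularity`.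
No normalisation (`W(0)`, `‖∇W‖_∞`) is imposed; the dilations `eulerLerayDilate μ`, `μ > 0`, act
on the class (`IsEulerLeraySkeleton.eulerLerayDilate`). Nontrivial skeletons are not known to exist.
[cite: PomeauBerreLehner2018, §3 eq. (NS-Leray) without the viscous term (“Euler–Leray equations”, steady case of §4 eq. (Euler-Leray1)) and §5 (decay 1/R)] -/
structure IsEulerLeraySkeleton (W : E → E) (P : E → ℝ) : Prop where
  /-- The velocity profile is `C²`. -/
  contDiff_velocity : ContDiff ℝ 2 W
  /-- The pressure profile is `C¹`. -/
  contDiff_pressure : ContDiff ℝ 1 P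
  /-- Incompressibility `div W = 0`. -/
  divFree : VectorCalculus.IsDivFree W
  /-- The steady Euler–Leray equation `½W + DW[½y + W] + ∇P = 0`. -/
  profile_eq : ∀ y, (1 / 2 : ℝ) • W y + fderiv ℝ W y ((1 / 2 : ℝ) • y + W y) + gradient P y = 0
  /-- Leray decay `|W(y)| ≤ C(1+|y|)⁻¹`, `‖DW(y)‖ ≤ C((1+|y|)²)⁻¹` for one constant `C`. -/
  decay : ∃ C : ℝ, ∀ y, ‖W y‖ ≤ C * (1 + ‖y‖)⁻¹ ∧ ‖fderiv ℝ W y‖ ≤ C * ((1 + ‖y‖) ^ 2)⁻¹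

/-- `IsEulerLeraySkeleton` unfolded to the five clauses the routes inline (definitional). [folklore] -/
theorem isEulerLeraySkeleton_iff (W : E → E) (P : E → ℝ) :
    IsEulerLeraySkeleton W P ↔
      ContDiff ℝ 2 W ∧ ContDiff ℝ 1 P ∧ VectorCalculus.IsDivFree W ∧
        (∀ y, (1 / 2 : ℝ) • W y + fderiv ℝ W y ((1 / 2 : ℝ) • y + W y) + gradient P y = 0) ∧
        ∃ C : ℝ, ∀ y, ‖W y‖ ≤ C * (1 + ‖y‖)⁻¹ ∧ ‖fderiv ℝ W y‖ ≤ C * ((1 + ‖y‖) ^ 2)⁻¹ :=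
  ⟨fun h => ⟨h.1, h.2, h.3, h.4, h.5⟩, fun h => ⟨h.1, h.2.1, h.2.2.1, h.2.2.2.1, h.2.2.2.2⟩⟩

omit [InnerProductSpace ℝ E] [FiniteDimensional ℝ E] in
/-- An admissible Leray-decay constant is nonnegative (evaluate the velocity bound at `0`). [folklore] -/
theorem nonneg_of_lerayDecay {F : Type*} [NormedAddCommGroup F] {W : E → F} {C : ℝ}
    (h : ∀ y, ‖W y‖ ≤ C * (1 + ‖y‖)⁻¹) : 0 ≤ C := by
  have h0 := h 0
  rw [norm_zero, add_zero, inv_one, mul_one] at h0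
  exact (norm_nonneg _).trans h0

namespace IsEulerLeraySkeleton

variable {W : E → E} {P : E → ℝ}

/-- **A skeleton is a CIV self-similar Euler profile with `γ = ½` and centre `0`.**
[cite: ConstantinIgnatovaVicol2026Putative, §3.1.1 eq. (3.3)] -/
theorem isSelfSimilarEulerProfile (h : IsEulerLeraySkeleton W P) :
    IsSelfSimilarEulerProfile (1 / 2 : ℝ) 0 W P where
  contDiff_velocity := h.contDiff_velocity
  contDiff_pressure := h.contDiff_pressure
  profile_eq y := by
    rw [sub_zero, show (1 - 1 / 2 : ℝ) = 1 / 2 by norm_num]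
    exact h.profile_eq y
  divFree := h.divFree

/-- Conversely, a `γ = ½`, centre-`0` profile with Leray decay is a skeleton.
[cite: ConstantinIgnatovaVicol2026Putative, §3.1.1 eq. (3.3)] -/
theorem of_isSelfSimilarEulerProfile (h : IsSelfSimilarEulerProfile (1 / 2 : ℝ) 0 W P)
    (hd : ∃ C : ℝ, ∀ y, ‖W y‖ ≤ C * (1 + ‖y‖)⁻¹ ∧ ‖fderiv ℝ W y‖ ≤ C * ((1 + ‖y‖) ^ 2)⁻¹) :
    IsEulerLeraySkeleton W P where
  contDiff_velocity := h.contDiff_velocity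
  contDiff_pressure := h.contDiff_pressure
  divFree := h.divFree
  profile_eq y := by
    have e := h.profile_eq y
    rwa [sub_zero, show (1 - 1 / 2 : ℝ) = 1 / 2 by norm_num] at e
  decay := hd

/-- **Pomeau's printed form** of the steady Euler–Leray equation:
`½(W + (y·∇)W) + (W·∇)W + ∇P = 0`, with `(y·∇)W = DW(y)[y]` and `(W·∇)W = convect W W`.
[cite: PomeauBerreLehner2018, §3 eq. (NS-Leray) (inviscid) and §4] -/
theorem profile_eq_convect (h : IsEulerLeraySkeleton W P) (y : E) :
    (1 / 2 : ℝ) • (W y + fderiv ℝ W y y) + convect W W y + gradient P y = 0 := by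
  have e := h.profile_eq y
  rw [map_add, map_smul] at e
  rw [convect_apply, smul_add, ← e]
  abel

/-- Constructor from Pomeau's printed form `½(W + (y·∇)W) + (W·∇)W + ∇P = 0`.
[cite: PomeauBerreLehner2018, §3 eq. (NS-Leray) (inviscid) and §4] -/
theorem of_convect (hW : ContDiff ℝ 2 W) (hP : ContDiff ℝ 1 P) (hdiv : VectorCalculus.IsDivFree W)
    (heq : ∀ y, (1 / 2 : ℝ) • (W y + fderiv ℝ W y y) + convect W W y + gradient P y = 0)
    (hd : ∃ C : ℝ, ∀ y, ‖W y‖ ≤ C * (1 + ‖y‖)⁻¹ ∧ ‖fderiv ℝ W y‖ ≤ C * ((1 + ‖y‖) ^ 2)⁻¹) :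
    IsEulerLeraySkeleton W P where
  contDiff_velocity := hW
  contDiff_pressure := hP
  divFree := hdiv
  profile_eq y := by
    have e := heq y
    rw [convect_apply, smul_add] at e
    rw [map_add, map_smul, ← e]
    abel
  decay := hd

/-- The velocity of a skeleton is differentiable. [folklore] -/
theorem differentiable_velocity (h : IsEulerLeraySkeleton W P) : Differentiable ℝ W :=
  h.contDiff_velocity.differentiable (by norm_num)

/-- The pressure of a skeleton is differentiable. [folklore] -/
theorem differentiable_pressure (h : IsEulerLeraySkeleton W P) : Differentiable ℝ P :=
  h.contDiff_pressure.differentiable one_ne_zero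

/-- The decay bounds with a NONNEGATIVE constant. [folklore] -/
theorem exists_nonneg_decay (h : IsEulerLeraySkeleton W P) :
    ∃ C : ℝ, 0 ≤ C ∧ ∀ y, ‖W y‖ ≤ C * (1 + ‖y‖)⁻¹ ∧ ‖fderiv ℝ W y‖ ≤ C * ((1 + ‖y‖) ^ 2)⁻¹ := by
  obtain ⟨C, hC⟩ := h.decay
  exact ⟨C, nonneg_of_lerayDecay fun y => (hC y).1, hC⟩

/-- A skeleton is bounded: `|W(y)| ≤ C`. [folklore] -/
theorem exists_forall_norm_le (h : IsEulerLeraySkeleton W P) : ∃ C : ℝ, ∀ y, ‖W y‖ ≤ C := by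
  obtain ⟨C, hC0, hC⟩ := h.exists_nonneg_decay
  refine ⟨C, fun y => ((hC y).1).trans ?_⟩
  have h1 : (1 + ‖y‖)⁻¹ ≤ 1 := inv_le_one_of_one_le₀ (le_add_of_nonneg_right (norm_nonneg _))
  calc C * (1 + ‖y‖)⁻¹ ≤ C * 1 := by gcongr
    _ = C := mul_one C

/-- **The trivial skeleton** `W = 0`, `P = 0` (the Liouville conjecture of route `AffineBernoulli`
is that it is the only one). [folklore] -/
protected theorem zero : IsEulerLeraySkeleton (0 : E → E) (0 : E → ℝ) :=
  of_isSelfSimilarEulerProfile (IsSelfSimilarEulerProfile.zero _ _)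
    ⟨0, fun y => by simp [Pi.zero_def]⟩

/-- **The dilation family preserves the skeleton class.** If `(W, P)` is an Euler–Leray skeleton
and `μ > 0`, so is `(μ⁻¹W(μ ·), μ⁻²P(μ ·))` (PLBL §5: "if (Euler-Leray) have a solution `U(R)`,
then [its dilation] is also a solution, with `μ` arbitrary"; CIV §3.1.2), the decay constant
becoming `C(1 + μ⁻¹)²`. [cite: PomeauBerreLehner2018, §5] -/
theorem eulerLerayDilate (h : IsEulerLeraySkeleton W P) {μ : ℝ} (hμ : 0 < μ) :
    IsEulerLeraySkeleton (eulerLerayDilate μ W) (eulerLerayDilatePressure μ P) := by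
  have hp := h.isSelfSimilarEulerProfile.eulerLerayDilate hμ.ne'
  rw [smul_zero] at hp
  obtain ⟨C, hC⟩ := h.decay
  exact of_isSelfSimilarEulerProfile hp ⟨C * (1 + μ⁻¹) ^ 2, decay_eulerLerayDilate hμ hC⟩

/-- The Bernoulli transport identity at `γ = ½`: along `V = ½y + W`, the self-similar Bernoulli
function `ℋ = ½|V|² + P − ⅛|y|²` is CONSTANT on trajectories, `Dℋ(y)[V(y)] = 0` (CIV (3.31) with
`2γ − 1 = 0`: Leray's exponent is the Kelvin-neutral one). [cite: ConstantinIgnatovaVicol2026Putative, §3.4.3 eq. (3.31)] -/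
theorem fderiv_selfSimilarBernoulli_transport (h : IsEulerLeraySkeleton W P) (y : E) :
    fderiv ℝ (selfSimilarBernoulli (1 / 2 : ℝ) 0 W P) y (selfSimilarTransport (1 / 2 : ℝ) 0 W y)
      = 0 := by
  rw [h.isSelfSimilarEulerProfile.fderiv_selfSimilarBernoulli_transport y]
  norm_num

end IsEulerLeraySkeleton

/-- **Centred profiles translate to skeletons.** If `(W, P)` solves the `γ = ½` profile equation
with centre `c`, `½W + DW[½(y − c) + W] + ∇P = 0`, and has Leray decay measured from the origin
(the clauses of `AffineBernoulli.EulerLerayLiouville`), then `(W(· + c), P(· + c))` is an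
Euler–Leray skeleton, with constant `C(1 + |c|)²` (`1 + |y| ≤ (1 + |c|)(1 + |y + c|)`). [folklore] -/
theorem IsSelfSimilarEulerProfile.isEulerLeraySkeleton_comp_add_right {c : E} {W : E → E}
    {P : E → ℝ} (h : IsSelfSimilarEulerProfile (1 / 2 : ℝ) c W P)
    (hd : ∃ C : ℝ, ∀ y, ‖W y‖ ≤ C * (1 + ‖y‖)⁻¹ ∧ ‖fderiv ℝ W y‖ ≤ C * ((1 + ‖y‖) ^ 2)⁻¹) :
    IsEulerLeraySkeleton (fun y => W (y + c)) (fun y => P (y + c)) := by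
  have hp := h.comp_add_right c
  rw [sub_self] at hp
  obtain ⟨C, hC⟩ := hd
  have hC0 : 0 ≤ C := nonneg_of_lerayDecay fun y => (hC y).1
  refine IsEulerLeraySkeleton.of_isSelfSimilarEulerProfile hp ⟨C * (1 + ‖c‖) ^ 2, fun y => ?_⟩
  have ha : 0 < 1 + ‖y + c‖ := by positivity
  have hb : 0 < 1 + ‖y‖ := by positivity
  have hK : 1 + ‖y‖ ≤ (1 + ‖c‖) * (1 + ‖y + c‖) := by
    have h1 : ‖y‖ ≤ ‖y + c‖ + ‖c‖ := by
      calc ‖y‖ = ‖(y + c) - c‖ := by rw [add_sub_cancel_right]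
        _ ≤ ‖y + c‖ + ‖c‖ := norm_sub_le _ _
    nlinarith [norm_nonneg (y + c), norm_nonneg c]
  have hinv : (1 + ‖y + c‖)⁻¹ ≤ (1 + ‖c‖) * (1 + ‖y‖)⁻¹ := by
    rw [← div_eq_mul_inv, le_div_iff₀ hb, inv_mul_le_iff₀ ha, mul_comm]
    exact hK
  have hinv2 : ((1 + ‖y + c‖) ^ 2)⁻¹ ≤ (1 + ‖c‖) ^ 2 * ((1 + ‖y‖) ^ 2)⁻¹ := by
    have hK2 : (1 + ‖y‖) ^ 2 ≤ (1 + ‖c‖) ^ 2 * (1 + ‖y + c‖) ^ 2 := by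
      rw [← mul_pow]; exact pow_le_pow_left₀ hb.le hK 2
    rw [← div_eq_mul_inv, le_div_iff₀ (pow_pos hb 2), inv_mul_le_iff₀ (pow_pos ha 2), mul_comm]
    exact hK2
  have hK1 : 1 + ‖c‖ ≤ (1 + ‖c‖) ^ 2 := by nlinarith [norm_nonneg c]
  refine ⟨?_, ?_⟩
  · calc ‖W (y + c)‖ ≤ C * (1 + ‖y + c‖)⁻¹ := (hC (y + c)).1
      _ ≤ C * ((1 + ‖c‖) * (1 + ‖y‖)⁻¹) := mul_le_mul_of_nonneg_left hinv hC0
      _ ≤ C * ((1 + ‖c‖) ^ 2 * (1 + ‖y‖)⁻¹) :=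
          mul_le_mul_of_nonneg_left (mul_le_mul_of_nonneg_right hK1 (by positivity)) hC0
      _ = C * (1 + ‖c‖) ^ 2 * (1 + ‖y‖)⁻¹ := by ring
  · rw [fderiv_comp_add_right]
    calc ‖fderiv ℝ W (y + c)‖ ≤ C * ((1 + ‖y + c‖) ^ 2)⁻¹ := (hC (y + c)).2
      _ ≤ C * ((1 + ‖c‖) ^ 2 * ((1 + ‖y‖) ^ 2)⁻¹) := mul_le_mul_of_nonneg_left hinv2 hC0
      _ = C * (1 + ‖c‖) ^ 2 * ((1 + ‖y‖) ^ 2)⁻¹ := by ring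

end Skeleton

/-! ### Three dimensions: CIV's far-field class at `γ = ½` consists of skeletons -/

section SpaceDimThree

/-- **CIV's `γ = ½` profiles are Euler–Leray skeletons.** A `γ = ½`, centre-`0` profile obeying the
far-field bounds (3.8), `|U(y)| ≤ C♭|y|⟨y⟩⁻²`, `|Ω(y)| + ‖DU(y)‖ ≤ C♭⟨y⟩⁻²`, is a skeleton with
constant `2C♭` (`|y|(1 + |y|) ≤ 2⟨y⟩²` and `(1 + |y|)² ≤ 2⟨y⟩²`). [cite: ConstantinIgnatovaVicol2026Putative, §3.1.3 eq. (3.8)] -/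
theorem IsSelfSimilarEulerProfile.isEulerLeraySkeleton_of_hasSelfSimilarFarFieldWith
    {U : EuclideanSpace ℝ (Fin 3) → EuclideanSpace ℝ (Fin 3)} {P : EuclideanSpace ℝ (Fin 3) → ℝ}
    {C : ℝ} (h : IsSelfSimilarEulerProfile (1 / 2 : ℝ) 0 U P)
    (hC : HasSelfSimilarFarFieldWith (1 / 2 : ℝ) 0 C U) : IsEulerLeraySkeleton U P := by
  have hC0 : 0 ≤ C := hC.nonneg
  refine IsEulerLeraySkeleton.of_isSelfSimilarEulerProfile h ⟨2 * C, fun y => ?_⟩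
  have hexp : (-(1 / (2 * (1 / 2 : ℝ)))) = -1 := by norm_num
  have h1 := hC.norm_le y
  have h2 := hC.norm_fderiv_le y
  rw [sub_zero, hexp, Real.rpow_neg_one] at h1 h2
  set t : ℝ := ‖y‖ with ht
  have ht0 : 0 ≤ t := norm_nonneg _
  have hb : 0 < 1 + t := by positivity
  have hq : 0 < 1 + t ^ 2 := by positivity
  refine ⟨?_, ?_⟩
  · -- `t (1 + t²)⁻¹ ≤ 2 (1 + t)⁻¹`
    have hK : t * (1 + t) ≤ 2 * (1 + t ^ 2) := by nlinarith [sq_nonneg (t - 1)]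
    have hle : t * (1 + t ^ 2)⁻¹ ≤ 2 * (1 + t)⁻¹ := by
      rw [← div_eq_mul_inv, ← div_eq_mul_inv, div_le_div_iff₀ hq hb]
      exact hK
    calc ‖U y‖ ≤ C * t * (1 + t ^ 2)⁻¹ := h1
      _ = C * (t * (1 + t ^ 2)⁻¹) := by ring
      _ ≤ C * (2 * (1 + t)⁻¹) := mul_le_mul_of_nonneg_left hle hC0
      _ = 2 * C * (1 + t)⁻¹ := by ring
  · -- `(1 + t²)⁻¹ ≤ 2 ((1 + t)²)⁻¹`
    have hK : (1 + t) ^ 2 ≤ 2 * (1 + t ^ 2) := by nlinarith [sq_nonneg (t - 1)]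
    have hle : (1 + t ^ 2)⁻¹ ≤ 2 * ((1 + t) ^ 2)⁻¹ := by
      rw [← div_eq_mul_inv, le_div_iff₀ (pow_pos hb 2), inv_mul_le_iff₀ hq, mul_comm]
      exact hK
    calc ‖fderiv ℝ U y‖ ≤ C * (1 + t ^ 2)⁻¹ := h2
      _ ≤ C * (2 * ((1 + t) ^ 2)⁻¹) := mul_le_mul_of_nonneg_left hle hC0
      _ = 2 * C * ((1 + t) ^ 2)⁻¹ := by ring

end SpaceDimThree

end Literature.Analysis.FluidPDE
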